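import Summits.ResolutionOfSingularities.ResolutionOfSingularities.Theses.WeightedInvariant
import Summits.ResolutionOfSingularities.ResolutionOfSingularities.Theorems.WeightedInvariantWeightedThesisHypersurfaceDatum
import Literature.AlgebraicGeometry.Resolution.MarkedIdeals
import HarnessLib

/-!
# Witness file — the rung family `TransversalRung d` specialises to the PROVED floor `d = 2`
(crux `GlobalizeLocalDrop`, stmt-ResolutionOfSingularities-14763; line
`Cruxes/GlobalizeLocalDrop/Lines/transversal_dimension_ladder.lean`, commit 22e5437ad2aa).

This file is SELF-CONTAINED (single-file check, as the sibling witness files of this summit): the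
definitions below (`SingularAt`, `IsHomogeneousPt`, `SlicedDropClause`, `UscClause`, `ComapClause`,
`SlicedLocalDrop`, `TransversalRung`, and the three named facts) are the line's definitions VERBATIM,
in the sub-namespace `.Special` (the `@[conjecture]` tags dropped on the copies); the in-module witness is `TransversalDimensionLadder.transversalRung_two`.
It shows, with NO `sorry`, that the graded family specialises to the proved level: transversal
dimension `2` (points of height `2` = plane-curve singularities inside smooth `k`-schemes), every
characteristic, with `Γ := ℕ∞`, `ι := ord`, from exactly three results in print used as named
facts (Literature style): Abramovich–Quek–Schober 2025 (arXiv:2507.01232 Thm 1.1 (1),(3) / Thm 1.3: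
order drop at every point over `y` after the canonical weighted blow-up `(x₁^{a₁}, x₂^{a₂})`, any
field), upper semicontinuity of the order on smooth schemes (Cossart–Piltant 2008 Prop. 4.2; in-tree
cousin `isClosed_setOf_le_idealOrder`) and invariance of the order under smooth morphisms (Kollár
2007, 3.34; in-tree cousins `idealOrder_comap_of_etale`, `mem_pow_maximalIdeal_iff_of_isRegularLocalRing_fiber`).
Regime note (F9): resolution (`S`) IS known in this regime (dimension ≤ 3, Cossart–Piltant 2019);
the witness exercises the rung family's mechanism — a ONE-MOVE drop of a usc, smooth-functorial,
history-free invariant under a weighted cobordant blow-up, sliced by height — which no resolution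
theorem in dimension ≤ 3 provides; the next rung `d = 3` is open (line file, `stub_rungThree`).
-/

noncomputable section

set_option linter.dupNamespace false

open CategoryTheory AlgebraicGeometry TopologicalSpace
open Literature.AlgebraicGeometry.Resolution

universe u

namespace Summit.ResolutionOfSingularities.ResolutionOfSingularities.Cruxes.GlobalizeLocalDrop.TransversalDimensionLadder.Special

/-- `X ⊆ Y` (an ideal sheaf) is **singular at** `y ∈ Y`: some point of `X.subscheme` over `y`
has a non-regular local ring (negation of the right-hand side of the datum axiom `(ii)`). -/
def SingularAt {Y : Scheme.{u}} (X : Y.IdealSheafData) (y : Y) : Prop :=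
  ∃ x : X.subscheme, X.subschemeι x = y ∧ ¬ IsRegularLocalRing (X.subscheme.presheaf.stalk x)

/-- A point of the full cobordant blow-up `B = Spec A[t⁻¹, Iₙ tⁿ]` is **homogeneous**: its prime
ideal contains, together with any element, each homogeneous component of that element (w.r.t.
the `ℤ`-grading of `A[t, t⁻¹]`).  These are exactly the `𝔾ₘ`-fixed points of `|B|`, i.e. the
generic points of the `𝔾ₘ`-stable irreducible closed subsets (orbit closures): the "closed
orbits `𝒬`" at whose generic points Abramovich–Quek–Schober localise. -/
def IsHomogeneousPt {A : Type u} [CommRing A] {I : ℕ → Ideal A}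
    (b : affineCobordantBlowup I) : Prop :=
  ∀ x ∈ (b : PrimeSpectrum (extReesAlgebra I)).asIdeal, ∀ n : ℤ,
    ∀ hx : LaurentPolynomial.C ((x : LaurentPolynomial A).coeff n) * LaurentPolynomial.T n ∈ extReesAlgebra I,
      (⟨_, hx⟩ : extReesAlgebra I) ∈ (b : PrimeSpectrum (extReesAlgebra I)).asIdeal

/-- The DROP clause of `SlicedLocalDrop p d` for a given invariant `ι`: for every perfect field
`k` of characteristic `p`, every smooth separated quasi-compact `f : Y → Spec k`, every integral
locally principal `X ⊆ Y` and every point `y ∈ Y` of height between `2` and `d` at which `X` is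
singular, there are an open `V ∋ y`, a Rees algebra `R` on `V` and an affine chart `U ∋ y` of `V`
on which `R` is the regular weighted centre `(u₁^{1/w₁}, …, uₘ^{1/wₘ})`, `m ≥ 1`, all `uᵢ`
vanishing at `y`, such that at every HOMOGENEOUS point `b` of the cobordant blow-up `B₊(U)` lying
over `y`, of height between `2` and `d`, at which the strict transform `X'` is singular,
`ι(B₊(U), X', b) < ι(Y, X, y)`. -/
def SlicedDropClause (p d : ℕ) {Γ : Type} [LT Γ]
    (ι : ∀ ⦃k : Type⦄ [Field k] ⦃Y : Scheme.{0}⦄, (Y ⟶ Spec (.of k)) → Y.IdealSheafData → Y → Γ) :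
    Prop :=
  ∀ ⦃k : Type⦄ [Field k] [CharP k p] [PerfectField k] ⦃Y : Scheme.{0}⦄
    (f : Y ⟶ Spec (.of k)) [Smooth f] [IsSeparated f] [QuasiCompact f]
    (X : Y.IdealSheafData), IsLocallyPrincipal X → IsIntegral X.subscheme →
    ∀ y : Y, ((2 : ℕ) : WithBot ℕ∞) ≤ ringKrullDim (Y.presheaf.stalk y) →
      ringKrullDim (Y.presheaf.stalk y) ≤ (d : WithBot ℕ∞) →
      SingularAt X y →
      ∃ (V : Y.Opens) (hyV : y ∈ V) (R : ReesAlgebraData (V : Scheme.{0}))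
        (U : (V : Scheme.{0}).affineOpens)
        (hyU : (⟨y, hyV⟩ : (V : Scheme.{0})) ∈ (U : (V : Scheme.{0}).Opens))
        (m : ℕ) (_ : 0 < m) (u : Fin m → Γ((V : Scheme.{0}), U)) (w : Fin m → ℕ),
        R.IsWeightedChart U u w ∧
        (∀ i, ((V : Scheme.{0}).presheaf.germ (U : (V : Scheme.{0}).Opens) ⟨y, hyV⟩ hyU).hom (u i) ∈
          IsLocalRing.maximalIdeal ((V : Scheme.{0}).presheaf.stalk ⟨y, hyV⟩)) ∧
        ∀ b : R.cobordantPlus U,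
          R.cobordantPlusι U b = ⟨y, hyV⟩ →
          IsHomogeneousPt ((affineCobordantBlowup.plusOpens (R.chartIdeals U)).ι b) →
          ((2 : ℕ) : WithBot ℕ∞) ≤ ringKrullDim ((R.cobordantPlus U).presheaf.stalk b) →
          ringKrullDim ((R.cobordantPlus U).presheaf.stalk b) ≤ (d : WithBot ℕ∞) →
          SingularAt (R.cobordantStrictTransform U (X.comap V.ι)) b →
            ι (R.cobordantPlusι U ≫ V.ι ≫ f) (R.cobordantStrictTransform U (X.comap V.ι)) b
              < ι f X y

/-- The UPPER-SEMICONTINUITY clause for an invariant `ι` (the datum's axiom (usc), verbatim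
shape of `WeightedResolutionDatum.isClosed_superlevel`): superlevel sets are closed. -/
def UscClause (p : ℕ) {Γ : Type} [LE Γ]
    (ι : ∀ ⦃k : Type⦄ [Field k] ⦃Y : Scheme.{0}⦄, (Y ⟶ Spec (.of k)) → Y.IdealSheafData → Y → Γ) :
    Prop :=
  ∀ ⦃k : Type⦄ [Field k] [CharP k p] [PerfectField k] ⦃Y : Scheme.{0}⦄
    (f : Y ⟶ Spec (.of k)) [Smooth f] [IsSeparated f] [QuasiCompact f] (X : Y.IdealSheafData)
    (γ : Γ), IsClosed {y : Y | γ ≤ ι f X y}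

/-- The SMOOTH-FUNCTORIALITY clause for an invariant `ι` (the datum's axiom (i) for smooth
`k`-morphisms, verbatim shape of `WeightedResolutionDatum.inv_comap`). -/
def ComapClause (p : ℕ) {Γ : Type}
    (ι : ∀ ⦃k : Type⦄ [Field k] ⦃Y : Scheme.{0}⦄, (Y ⟶ Spec (.of k)) → Y.IdealSheafData → Y → Γ) :
    Prop :=
  ∀ ⦃k : Type⦄ [Field k] [CharP k p] [PerfectField k] ⦃Y Y₁ : Scheme.{0}⦄
    (f : Y ⟶ Spec (.of k)) [Smooth f] [IsSeparated f] [QuasiCompact f]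
    (f₁ : Y₁ ⟶ Spec (.of k)) [Smooth f₁] [IsSeparated f₁] [QuasiCompact f₁]
    (g : Y₁ ⟶ Y) [Smooth g], g ≫ f = f₁ →
    ∀ (X : Y.IdealSheafData) (y₁ : Y₁), ι f₁ (X.comap g) y₁ = ι f X (g y₁)

/-- **Sliced local weighted drop in transversal dimension `≤ d` (characteristic `p`).**
There are a well-ordered value set `Γ` and an invariant `ι` of (ambient `k`-scheme, ideal sheaf,
point) which is UPPER SEMICONTINUOUS on every smooth `Y` (`UscClause`), FUNCTORIAL FOR SMOOTH
`k`-MORPHISMS (`ComapClause`) — the two axioms (usc), (i) of a weighted resolution datum that make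
an invariant intrinsic — and which DROPS in the sliced weighted game up to transversal dimension
`d` (`SlicedDropClause`).  Without (usc)+(i) the statement would follow classically in every `d`
for which embedded resolution of `(d-1)`-folds is known (game rank of the weights-`1` game, e.g.
`d = 3` from Cossart–Jannsen–Saito 2009); with them it is the local, sliced shadow of the datum. -/
def SlicedLocalDrop (p d : ℕ) : Prop :=
  ∃ (Γ : Type) (_ : LinearOrder Γ) (_ : WellFoundedLT Γ)
    (ι : ∀ ⦃k : Type⦄ [Field k] ⦃Y : Scheme.{0}⦄, (Y ⟶ Spec (.of k)) → Y.IdealSheafData → Y → Γ),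
    UscClause p ι ∧ ComapClause p ι ∧ SlicedDropClause p d ι

/-- **Rung `d` of the transversal-dimension ladder**: sliced local weighted drop in transversal
dimension `≤ d` in every positive characteristic. -/
def TransversalRung (d : ℕ) : Prop :=
  ∀ p : ℕ, p.Prime → SlicedLocalDrop p d


/-! ## The floor: Abramovich–Quek–Schober 2025 (transversal dimension two), as a named fact -/

/-- **Abramovich–Quek–Schober 2025, order drop under the canonical weighted blow-up in
transversal dimension two** (the printed Theorems 1.1 (1),(3) / 1.3 (1),(3), specialised to a
smooth ambient scheme over a field and written on an affine neighbourhood of the point, as in the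
proof of Thm. 1.1, which passes "to the localization at the generic point of `𝒬`"): for a
hypersurface `X` (integral, locally principal) in `Y` smooth over a field `k`, and a point `y ∈ Y`
of height `2` at which `X` is singular, there is a regular weighted centre
`J̄ = (u₁^{1/w₁}, u₂^{1/w₂})` through `y` on an affine neighbourhood (`J = (x₁^{a₁}, x₂^{a₂})`,
`a₁ = ord_y X`, `a₂ = a₁ δ`, `δ` the vertex of Hironaka's characteristic polyhedron) such that on
the cobordant blow-up `B₊` the strict transform has ORDER `< a₁ = ord_y X` at every point over `y`.
Any field, any characteristic. A NAMED FACT (hypothesis), to be promoted to `Literature/`.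
[cite: arXiv:2507.01232, Thm. 1.1 (1),(3) and Thm. 1.3 (1),(3)] -/
def AbramovichQuekSchober2025 : Prop :=
  ∀ ⦃k : Type⦄ [Field k] ⦃Y : Scheme.{0}⦄
    (f : Y ⟶ Spec (.of k)) [Smooth f] [IsSeparated f] [QuasiCompact f]
    (X : Y.IdealSheafData), IsLocallyPrincipal X → IsIntegral X.subscheme →
    ∀ y : Y, ringKrullDim (Y.presheaf.stalk y) = ((2 : ℕ) : WithBot ℕ∞) → SingularAt X y →
      ∃ (V : Y.Opens) (hyV : y ∈ V) (R : ReesAlgebraData (V : Scheme.{0}))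
        (U : (V : Scheme.{0}).affineOpens)
        (hyU : (⟨y, hyV⟩ : (V : Scheme.{0})) ∈ (U : (V : Scheme.{0}).Opens))
        (u : Fin 2 → Γ((V : Scheme.{0}), U)) (w : Fin 2 → ℕ),
        R.IsWeightedChart U u w ∧
        (∀ i, ((V : Scheme.{0}).presheaf.germ (U : (V : Scheme.{0}).Opens) ⟨y, hyV⟩ hyU).hom (u i) ∈
          IsLocalRing.maximalIdeal ((V : Scheme.{0}).presheaf.stalk ⟨y, hyV⟩)) ∧
        ∀ b : R.cobordantPlus U, R.cobordantPlusι U b = ⟨y, hyV⟩ →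
          idealOrder (R.cobordantStrictTransform U (X.comap V.ι)) b < idealOrder X y

/-- **Upper semicontinuity of the order of an ideal sheaf on a smooth scheme over a field**
(Hironaka; Cossart–Piltant 2008, proof of Prop. 4.2; in the tree for integral Noetherian regular
excellent schemes as `isClosed_setOf_le_idealOrder`): every superlevel set `{y | γ ≤ ord_y X}` is
closed. A NAMED FACT (hypothesis). [cite: CossartPiltant2008, Prop. 4.2 (proof)] -/
def OrderUpperSemicontinuous : Prop :=
  ∀ ⦃k : Type⦄ [Field k] ⦃Y : Scheme.{0}⦄
    (f : Y ⟶ Spec (.of k)) [Smooth f] [IsSeparated f] [QuasiCompact f] (X : Y.IdealSheafData)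
    (γ : ℕ∞), IsClosed {y : Y | γ ≤ idealOrder X y}

/-- **The order of an ideal sheaf is invariant under smooth morphisms** (flat local homomorphisms
with regular closed fibre preserve `𝔪`-adic orders; in the tree: `idealOrder_comap_of_etale`,
`mem_pow_maximalIdeal_iff_of_isRegularLocalRing_fiber`): `ord_{y₁}(g⁻¹X) = ord_{g y₁}(X)` for a
smooth `k`-morphism `g : Y₁ → Y`. A NAMED FACT (hypothesis). [cite: Kollar2007, 3.34.1 (p. 131)] -/
def OrderSmoothInvariant : Prop :=
  ∀ ⦃k : Type⦄ [Field k] ⦃Y Y₁ : Scheme.{0}⦄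
    (f : Y ⟶ Spec (.of k)) [Smooth f] [IsSeparated f] [QuasiCompact f]
    (f₁ : Y₁ ⟶ Spec (.of k)) [Smooth f₁] [IsSeparated f₁] [QuasiCompact f₁]
    (g : Y₁ ⟶ Y) [Smooth g], g ≫ f = f₁ →
    ∀ (X : Y.IdealSheafData) (y₁ : Y₁), idealOrder (X.comap g) y₁ = idealOrder X (g y₁)

/-- **Floor of the ladder (`d = 2`) from AQS 2025**: with `Γ := ℕ∞` and `ι := ord` (the order of
the hypersurface at the point; usc and smooth-functorial by the two classical order facts), the
sliced drop in transversal dimension `≤ 2` is the AQS theorem: positions have height exactly `2`,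
the centre has two parameters, and the order drops at every point of `B₊` over `y` — in particular
at the homogeneous singular ones. [folklore] -/
theorem transversalRung_two (h : AbramovichQuekSchober2025) (husc : OrderUpperSemicontinuous)
    (hcomap : OrderSmoothInvariant) : TransversalRung 2 := by
  intro p _
  refine ⟨ℕ∞, inferInstance, inferInstance, fun k _ Y f X y => idealOrder X y, ?_, ?_, ?_⟩
  · intro k _ _ _ Y f _ _ _ X γ
    exact husc f X γ
  · intro k _ _ _ Y Y₁ f _ _ _ f₁ _ _ _ g _ hg X y₁
    exact hcomap f f₁ g hg X y₁
  · intro k _ _ _ Y f _ _ _ X hX hXi y h2 hd hs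
    obtain ⟨V, hyV, R, U, hyU, u, w, hc, hm, hdrop⟩ := h f X hX hXi y (le_antisymm hd h2) hs
    exact ⟨V, hyV, R, U, hyU, 2, two_pos, u, w, hc, hm, fun b hb _ _ _ _ => hdrop b hb⟩

/-- The floor rung, by name (the F3 `example`). [folklore] -/
example (h : AbramovichQuekSchober2025) (husc : OrderUpperSemicontinuous)
    (hcomap : OrderSmoothInvariant) : TransversalRung 2 :=
  transversalRung_two h husc hcomap

end Summit.ResolutionOfSingularities.ResolutionOfSingularities.Cruxes.GlobalizeLocalDrop.TransversalDimensionLadder.Special
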